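import Summits.Ventures.LatticeQCDFlow.Scaling.SimulatedTemperingModeTorpid

/-!
HONEST FRAMING: exact (Metropolis-corrected) sampling algorithms for lattice gauge theory; figures
of merit are autocorrelation/cost numbers at stated couplings and volumes; no continuum-physics
claim.

# LevelSchemeCutCeiling — THE WEAKEST LINK OF SIMULATED TEMPERING: FOR `P = t·Q + (1−t)·W` (`W` THE WITHIN-LEVEL
# UPDATE, `Q` ANY LEVEL MOVE) AND ANY CUT OF THE LADDER BETWEEN LEVELS `j` AND `j+1`,
# `Gap(P) ≤ t(K+1)²·e_j(Q)/((j+1)(K−j))` (`Q` `π`-REVERSIBLE; `e_j(Q)` = THE STATIONARY FLOW OF `Q` ACROSS THE CUT), AND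
# WITH `π` MERELY STATIONARY (NON-REVERSIBLE LEVEL SWEEPS AND UPDATES INCLUDED) `d(n) ≤ ¼ ⇒ min{j+1, K−j} ≤
# 4n·t(K+1)·e_j(Q)`; FOR THE METROPOLIS LEVEL MOVE `e_j = ov(j,j+1)/(2(K+1))`, SO `Gap(stFinSampler t μ M) ≤ t·ov(j,j+1)`
# FOR EVERY ADJACENT PAIR AND `t_mix ≥ min{j+1, K−j}/(2t·ov(j,j+1))` — ONE POORLY OVERLAPPING PAIR OF ADJACENT
# COUPLINGS THROTTLES THE WHOLE SAMPLER (lean-2 GEN-20, ours)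

Venture-side (OURS).  Cell `lqcd-flow` (pub-lqcd), unit `pub-lqcd-lean-2-g20`, 2026-08-25.  Chapter H (universal
ceilings); the simulated-tempering companion of `ExchangeSchemeCutCeiling`.  Setting of `SimulatedTemperingFiniteSampler`:
state `(k, x) ∈ Fin (K+1) × S` (`S` finite), target `π(k,x) = μ_k(x)/(K+1)` (`stFinLaw μ`, exact weights), within-level
update `W = stFinWithin M` (`M_k` row-stochastic), a LEVEL MOVE `Q` (any row-stochastic kernel), `P = t·Q + (1−t)·W`.
For a cut `j : Fin K` the set `T_j = lowerLadder S j` of states at levels `≤ j` has `π(T_j) = (j+1)/(K+1)`; `W` never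
crosses the cut, so the flow of `P` across it is `t·e_j(Q)`, `e_j(Q) = edgeMeasure π Q T_j T_jᶜ`;
`ov(i,l) = stFinOverlap μ i l = Σ_x min{μ_i(x), μ_l(x)}`.

## What is proved (finite-chain vocabulary of `Literature.Probability.MarkovChains`)

* §1 `lowerLadder`, `stFin_mass_lowerLadder` (`(j+1)/(K+1)`), `stFin_mass_compl_lowerLadder`,
  `levelScheme_edgeMeasure_lowerLadder` (`= t·e_j(Q)`), `stFin_lawVariance_cutTestFun`; the scheme is row-stochastic /
  reversible / STATIONARY when `Q` and the `M_k` are (`levelScheme_isRowStochastic`, `levelScheme_detailedBalance`,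
  `stFinWithin_isStationary`, `levelScheme_isStationary`).
* §2 ANY LEVEL MOVE.  **`levelSchemeCut_spectralGap_le`**: `Q` `π`-reversible, `M_k` `μ_k`-reversible, `0 ≤ t ≤ 1` ⇒
  `Gap(P) ≤ t(K+1)²·e_j(Q)/((j+1)(K−j))` (Levin–Peres–Wilmer Lemma 13.7 + Remark 13.8, test function `f_{T_j}`, PROVED in
  the tree).  **`levelSchemeCut_mixing_floor_lower` / `_upper`**: `π` merely STATIONARY for `Q` and for every `M_k`
  and `d(n) ≤ ¼` ⇒ `j+1 ≤ 4n·t(K+1)·e_j(Q)` if `2(j+1) ≤ K+1`, `K−j ≤ 4n·t(K+1)·e_j(Q)` if `2(K−j) ≤ K+1`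
  (Levin–Peres–Wilmer Theorem 7.4 + Exercise 7.2, PROVED in the tree).
* §3 THE METROPOLIS LEVEL MOVE (`Q = stFinLevel μ`, `P = stFinSampler t μ M`).  **`stFinLevel_edgeMeasure_lowerLadder`**
  (`e_j = ov(j,j+1)/(2(K+1))`); **`stFinCut_spectralGap_le`** (`Gap ≤ t(K+1)·ov(j,j+1)/(2(j+1)(K−j))`);
  **`stFinCut_spectralGap_le_overlap`** (`Gap ≤ t·ov(j,j+1)` for EVERY adjacent pair); **`stFinCut_mixing_floor`**
  (`d(n) ≤ ¼ ⇒ min{j+1, K−j} ≤ 2n·t·ov(j,j+1)`, within-level updates merely `μ_k`-stationary);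
  **`stFinCut_tauInt_ge`** (`τ_int(f_{T_j}) ≥ 2(j+1)(K−j)/(t(K+1)·ov(j,j+1)) − ½`, `0 < t < 1`, irreducible `M_k`).

Reading (no numerics implied): the chapter-X floor `Gap ≥ min{ta/(3(K+1)²), a(1−t)γ_M/(3(K+1)²+a)}`
(`SimulatedTemperingFiniteGap`) charges the LEAST adjacent overlap `a`; here the charge is shown genuine — the gap is at
most `t` times every adjacent overlap whatever the within-level algorithm (even perfect independent sampling at every
level) — and no learned level proposal escapes it: long-range jumps, maps between couplings, lifted non-reversible
sweeps enter only through their stationary flow across each cut.  The diffusive law (`AdjacentLevelSchemeDiffusiveCeiling`)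
and this per-cut law are independent ceilings.  NOT CLAIMED: floors; general configuration spaces; replica exchange
(`ExchangeSchemeCutCeiling`); anything measured.  Literature grade (cell rule): KNOWN MECHANISM (conductance bounds:
Lawler–Sokal 1988, Sinclair–Jerrum 1989, Levin–Peres–Wilmer Thms 7.4 / 13.10, PROVED in the tree), NEW TYPING (per-cut form
for arbitrary, possibly non-reversible exact-weight level schemes; the overlap instance); nothing cited as a fact; no new
bib keys.
-/

noncomputable section

open Finset Function
open Literature.Probability.MarkovChains

namespace Summit.Ventures.LatticeQCDFlow.Scaling

variable {S : Type*} [Fintype S] {K : ℕ} {μ : Fin (K + 1) → S → ℝ}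
  {M : Fin (K + 1) → Matrix S S ℝ} {t : ℝ} {Q : Matrix (Fin (K + 1) × S) (Fin (K + 1) × S) ℝ}

/-! ## §1 The lower part of the ladder and the level scheme -/

variable (S) in
/-- The states at levels `0, …, j`: the lower side of the cut of the ladder between levels `j` and `j+1`. [ours] -/
def lowerLadder (j : Fin K) : Finset (Fin (K + 1) × S) := univ.filter fun p => p.1 ≤ j.castSucc

/-- Membership in the lower part is `level ≤ j`. [ours] -/
theorem mem_lowerLadder {j : Fin K} {p : Fin (K + 1) × S} : p ∈ lowerLadder S j ↔ (p.1 : ℕ) ≤ j := by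
  unfold lowerLadder; simp [Fin.le_def]

/-- **`π(T_j) = (j+1)/(K+1)`** (exact weights: the level marginal is uniform). [ours] -/
theorem stFin_mass_lowerLadder (hμ1 : ∀ k, ∑ x, μ k x = 1) (j : Fin K) :
    ∑ p ∈ lowerLadder S j, stFinLaw μ p = (((j : ℕ) : ℝ) + 1) / (K + 1) := by
  unfold lowerLadder
  rw [sum_filter, Fintype.sum_prod_type]
  have h : ∀ k : Fin (K + 1), ∑ x : S, (if ((k, x) : Fin (K + 1) × S).1 ≤ j.castSucc then stFinLaw μ (k, x) else 0)
      = if k ≤ j.castSucc then (1 : ℝ) / (K + 1) else 0 := fun k => by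
    split_ifs with hk
    · unfold stFinLaw; rw [← sum_div, hμ1 k]
    · simp
  have e : (univ.filter fun k : Fin (K + 1) => k ≤ j.castSucc) = Iic j.castSucc := by ext k; simp
  simp_rw [h]
  rw [← sum_filter, sum_const, e, Fin.card_Iic, Fin.val_castSucc, nsmul_eq_mul]
  push_cast
  ring

/-- The level scheme is a transition matrix (`0 ≤ t ≤ 1`). [ours] -/
theorem levelScheme_isRowStochastic (hQ : IsRowStochastic Q) (hM : ∀ k, IsRowStochastic (M k)) (ht0 : 0 ≤ t)
    (ht1 : t ≤ 1) : IsRowStochastic (fun p q : Fin (K + 1) × S => t * Q p q + (1 - t) * stFinWithin M p q) := by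
  have hW := stFinWithin_isRowStochastic (K := K) hM
  refine ⟨fun p q => add_nonneg (mul_nonneg ht0 (hQ.1 p q)) (mul_nonneg (by linarith) (hW.1 p q)), fun p => ?_⟩
  simp only
  rw [sum_add_distrib, ← mul_sum, ← mul_sum, hQ.2 p, hW.2 p]
  ring

omit [Fintype S] in
/-- The level scheme is in detailed balance with `π` when `Q` and the `M_k` are. [ours] -/
theorem levelScheme_detailedBalance (hQrev : DetailedBalance (stFinLaw μ) Q)
    (hMrev : ∀ k, DetailedBalance (μ k) (M k)) (t : ℝ) :
    DetailedBalance (stFinLaw μ) (fun p q : Fin (K + 1) × S => t * Q p q + (1 - t) * stFinWithin M p q) := by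
  intro p q
  have h1 := hQrev p q
  have h2 := stFinWithin_detailedBalance (μ := μ) hMrev p q
  linear_combination t * h1 + (1 - t) * h2

/-- **`π` is stationary for the within-level update as soon as every `μ_k` is stationary for `M_k`** (no
reversibility). [ours] -/
theorem stFinWithin_isStationary (hMst : ∀ k, IsStationary (μ k) (M k)) : IsStationary (stFinLaw μ) (stFinWithin M) := by
  intro q
  rw [Fintype.sum_prod_type, Finset.sum_eq_single q.1 (fun k _ hk => ?_) (fun h => absurd (mem_univ _) h)]
  · have h := hMst q.1 q.2
    calc ∑ x, stFinLaw μ (q.1, x) * stFinWithin M (q.1, x) q = ∑ x, μ q.1 x * M q.1 x q.2 / (K + 1) := by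
          refine sum_congr rfl fun x _ => ?_
          rw [stFinWithin_apply, if_pos rfl]
          unfold stFinLaw
          ring
      _ = stFinLaw μ q := by rw [← sum_div, h]; rfl
  · refine sum_eq_zero fun x _ => ?_
    rw [stFinWithin_apply, if_neg (fun h => hk h.symm), mul_zero]

/-- **`π` is stationary for the level scheme when it is stationary for `Q` and every `μ_k` for `M_k`** — non-reversible
level moves and within-level updates included. [ours] -/
theorem levelScheme_isStationary (hQst : IsStationary (stFinLaw μ) Q) (hMst : ∀ k, IsStationary (μ k) (M k)) (t : ℝ) :
    IsStationary (stFinLaw μ) (fun p q : Fin (K + 1) × S => t * Q p q + (1 - t) * stFinWithin M p q) := by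
  intro q
  have h1 := hQst q
  have h2 := stFinWithin_isStationary hMst q
  calc ∑ p, stFinLaw μ p * (t * Q p q + (1 - t) * stFinWithin M p q)
      = t * ∑ p, stFinLaw μ p * Q p q + (1 - t) * ∑ p, stFinLaw μ p * stFinWithin M p q := by
        rw [mul_sum, mul_sum, ← sum_add_distrib]; exact sum_congr rfl fun p _ => by ring
    _ = stFinLaw μ q := by rw [h1, h2]; ring

/-- A cut witnesses two distinct states (levels `0` and `K ≥ 1`, `S` nonempty). [ours] -/
theorem nontrivial_of_cut (hμ1 : ∀ k, ∑ x, μ k x = 1) (j : Fin K) : Nontrivial (Fin (K + 1) × S) := by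
  haveI : Nonempty S := by
    by_contra h
    have := hμ1 0
    rw [not_nonempty_iff] at h
    rw [Finset.univ_eq_empty, Finset.sum_empty] at this
    exact zero_ne_one this
  haveI : Nontrivial (Fin (K + 1)) := Fin.nontrivial_iff_two_le.mpr (by have := j.isLt; omega)
  infer_instance

variable [DecidableEq S]

/-- Membership in the upper part is `j < level`. [ours] -/
theorem mem_compl_lowerLadder {j : Fin K} {p : Fin (K + 1) × S} : p ∈ (lowerLadder S j)ᶜ ↔ (j : ℕ) < p.1 := by
  rw [mem_compl, mem_lowerLadder, not_le]

/-- **`π(T_jᶜ) = (K−j)/(K+1)`.** [ours] -/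
theorem stFin_mass_compl_lowerLadder (hμ1 : ∀ k, ∑ x, μ k x = 1) (j : Fin K) :
    ∑ p ∈ (lowerLadder S j)ᶜ, stFinLaw μ p = ((K : ℝ) - j) / (K + 1) := by
  have h := sum_add_sum_compl (lowerLadder S j) (stFinLaw μ)
  rw [sum_stFinLaw hμ1, stFin_mass_lowerLadder hμ1] at h
  rw [show ∑ p ∈ (lowerLadder S j)ᶜ, stFinLaw μ p = 1 - (((j : ℕ) : ℝ) + 1) / (K + 1) by linarith]
  field_simp
  ring

/-- **The within-level update never crosses a cut; the scheme's flow across it is `t` times the level move's:**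
`Q_π(P; T_j, T_jᶜ) = t·e_j(Q)`. [ours] -/
theorem levelScheme_edgeMeasure_lowerLadder (t : ℝ) (Q : Matrix (Fin (K + 1) × S) (Fin (K + 1) × S) ℝ)
    (M : Fin (K + 1) → Matrix S S ℝ) (j : Fin K) :
    edgeMeasure (stFinLaw μ) (fun p q => t * Q p q + (1 - t) * stFinWithin M p q) (lowerLadder S j) (lowerLadder S j)ᶜ
      = t * edgeMeasure (stFinLaw μ) Q (lowerLadder S j) (lowerLadder S j)ᶜ := by
  unfold edgeMeasure
  rw [mul_sum]
  refine sum_congr rfl fun p hp => ?_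
  rw [mul_sum]
  refine sum_congr rfl fun q hq => ?_
  rw [mem_lowerLadder] at hp
  have hne : q.1 ≠ p.1 := fun e => by rw [mem_compl_lowerLadder, e] at hq; omega
  simp only [stFinWithin_apply, hne, if_false, mul_zero, add_zero]
  ring

/-- `Var_π(f_{T_j}) = (j+1)(K−j)/(K+1)²`. [ours] -/
theorem stFin_lawVariance_cutTestFun (hμ1 : ∀ k, ∑ x, μ k x = 1) (j : Fin K) :
    lawVariance (stFinLaw μ) (bottleneckTestFun (stFinLaw μ) (lowerLadder S j))
      = (((j : ℕ) : ℝ) + 1) / (K + 1) * (((K : ℝ) - j) / (K + 1)) := by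
  rw [lawVariance_bottleneckTestFun (sum_stFinLaw hμ1), stFin_mass_lowerLadder hμ1, stFin_mass_compl_lowerLadder hμ1]

/-! ## §2 The per-cut ceiling and mixing floor for every level scheme -/

section Scheme

variable (hμ : ∀ k x, 0 < μ k x) (hμ1 : ∀ k, ∑ x, μ k x = 1) (hM : ∀ k, IsRowStochastic (M k)) (ht0 : 0 ≤ t)
  (ht1 : t ≤ 1) (hQ : IsRowStochastic Q)
include hμ hμ1 hM ht0 ht1 hQ

/-- **THE PER-CUT CEILING FOR EVERY LEVEL SCHEME:** `Q` row-stochastic `π`-reversible, `M_k` `μ_k`-reversible,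
`0 ≤ t ≤ 1`, any cut `j` ⇒ `Gap(t·Q + (1−t)·W) ≤ t·(K+1)²·e_j(Q)/((j+1)(K−j))`. [ours] -/
theorem levelSchemeCut_spectralGap_le (hMrev : ∀ k, DetailedBalance (μ k) (M k))
    (hQrev : DetailedBalance (stFinLaw μ) Q) (j : Fin K) :
    spectralGap (stFinLaw μ) (fun p q : Fin (K + 1) × S => t * Q p q + (1 - t) * stFinWithin M p q)
      ≤ t * (K + 1) ^ 2 * edgeMeasure (stFinLaw μ) Q (lowerLadder S j) (lowerLadder S j)ᶜ
          / ((((j : ℕ) : ℝ) + 1) * ((K : ℝ) - j)) := by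
  haveI := nontrivial_of_cut (μ := μ) hμ1 j
  have hP := levelScheme_isRowStochastic hQ hM ht0 ht1
  have hDB := levelScheme_detailedBalance hQrev hMrev t
  have hπ1 := sum_stFinLaw (K := K) hμ1
  have hK : (0 : ℝ) < K + 1 := by positivity
  have hjK : ((j : ℕ) : ℝ) < K := by exact_mod_cast j.isLt
  have hVar := stFin_lawVariance_cutTestFun (μ := μ) hμ1 j
  have hVpos : 0 < lawVariance (stFinLaw μ) (bottleneckTestFun (stFinLaw μ) (lowerLadder S j)) := by
    rw [hVar]; exact mul_pos (div_pos (by positivity) hK) (div_pos (by linarith) hK)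
  rw [LevinPeres2017_lemma_13_7 (stFinLaw_pos hμ) hπ1 hP hDB]
  refine (spectralGapR_le_dirichletForm_div_lawVariance (fun p => (stFinLaw_pos hμ p).le) hπ1 hP.1 hVpos).trans
    (le_of_eq ?_)
  have h1 : ((j : ℕ) : ℝ) + 1 ≠ 0 := by positivity
  have h2 : (K : ℝ) - j ≠ 0 := by linarith
  rw [dirichletForm_bottleneckTestFun hP (hDB.isStationary hP.2) hπ1, levelScheme_edgeMeasure_lowerLadder, hVar]
  field_simp

/-- **THE PER-CUT MIXING FLOOR, NO REVERSIBILITY:** `π` stationary for `Q` and every `μ_k` for `M_k`, `0 ≤ t ≤ 1`, a cut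
with `2(j+1) ≤ K+1` and `d(n) ≤ ¼` ⇒ `j+1 ≤ 4n·t·(K+1)·e_j(Q)` (Levin–Peres–Wilmer Theorem 7.4 with `S = T_j`). [ours] -/
theorem levelSchemeCut_mixing_floor_lower (hMst : ∀ k, IsStationary (μ k) (M k))
    (hQst : IsStationary (stFinLaw μ) Q) (j : Fin K) (hj : 2 * ((j : ℕ) + 1) ≤ K + 1) {n : ℕ}
    (hn : worstTvDist (fun p q : Fin (K + 1) × S => t * Q p q + (1 - t) * stFinWithin M p q) (stFinLaw μ) n ≤ 1 / 4) :
    ((j : ℕ) : ℝ) + 1 ≤ 4 * n * (t * (K + 1) * edgeMeasure (stFinLaw μ) Q (lowerLadder S j) (lowerLadder S j)ᶜ) := by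
  have hP := levelScheme_isRowStochastic hQ hM ht0 ht1
  have hst := levelScheme_isStationary hQst hMst t
  have hK : (0 : ℝ) < K + 1 := by positivity
  have hmT := stFin_mass_lowerLadder (μ := μ) hμ1 j
  have hS0 : 0 < ∑ p ∈ lowerLadder S j, stFinLaw μ p := by rw [hmT]; positivity
  have hS : ∑ p ∈ lowerLadder S j, stFinLaw μ p ≤ 1 / 2 := by
    have hj' : 2 * (((j : ℕ) : ℝ) + 1) ≤ K + 1 := by exact_mod_cast hj
    rw [hmT, div_le_iff₀ hK]; linarith
  have h := LevinPeres2017_thm_7_4_set hP hst (fun p => (stFinLaw_pos hμ p).le) (sum_stFinLaw hμ1) hS0 hS hn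
  unfold bottleneckRatio at h
  rw [levelScheme_edgeMeasure_lowerLadder, hmT] at h
  have hj1 : (0 : ℝ) < ((j : ℕ) : ℝ) + 1 := by positivity
  rw [div_div_eq_mul_div, ← mul_div_assoc, le_div_iff₀ hj1, one_mul] at h
  linarith

/-- **The same for the upper part:** `2(K−j) ≤ K+1` and `d(n) ≤ ¼` ⇒ `K−j ≤ 4n·t·(K+1)·e_j(Q)` (Theorem 7.4 with
`S = T_jᶜ`; the flow `T_jᶜ → T_j` equals `e_j(Q)` by Exercise 7.2, stationarity only). [ours] -/
theorem levelSchemeCut_mixing_floor_upper (hMst : ∀ k, IsStationary (μ k) (M k))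
    (hQst : IsStationary (stFinLaw μ) Q) (j : Fin K) (hj : 2 * (K - (j : ℕ)) ≤ K + 1) {n : ℕ}
    (hn : worstTvDist (fun p q : Fin (K + 1) × S => t * Q p q + (1 - t) * stFinWithin M p q) (stFinLaw μ) n ≤ 1 / 4) :
    ((K : ℝ) - j) ≤ 4 * n * (t * (K + 1) * edgeMeasure (stFinLaw μ) Q (lowerLadder S j) (lowerLadder S j)ᶜ) := by
  have hP := levelScheme_isRowStochastic hQ hM ht0 ht1
  have hst := levelScheme_isStationary hQst hMst t
  have hK : (0 : ℝ) < K + 1 := by positivity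
  have hjK : ((j : ℕ) : ℝ) < K := by exact_mod_cast j.isLt
  have hmT := stFin_mass_compl_lowerLadder (μ := μ) hμ1 j
  have hS0 : 0 < ∑ p ∈ (lowerLadder S j)ᶜ, stFinLaw μ p := by rw [hmT]; exact div_pos (by linarith) hK
  have hS : ∑ p ∈ (lowerLadder S j)ᶜ, stFinLaw μ p ≤ 1 / 2 := by
    have h2 : (((2 * (K - (j : ℕ))) : ℕ) : ℝ) ≤ ((K + 1 : ℕ) : ℝ) := by exact_mod_cast hj
    push_cast [Nat.cast_sub (j.isLt.le : (j : ℕ) ≤ K)] at h2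
    rw [hmT, div_le_iff₀ hK]; linarith
  have h := LevinPeres2017_thm_7_4_set hP hst (fun p => (stFinLaw_pos hμ p).le) (sum_stFinLaw hμ1) hS0 hS hn
  unfold bottleneckRatio at h
  rw [compl_compl, ← edgeMeasure_compl_comm hP hst (lowerLadder S j), levelScheme_edgeMeasure_lowerLadder, hmT] at h
  have hj1 : (0 : ℝ) < (K : ℝ) - j := by linarith
  rw [div_div_eq_mul_div, ← mul_div_assoc, le_div_iff₀ hj1, one_mul] at h
  linarith

end Scheme

/-! ## §3 The Metropolis level move: the flow across a cut is the overlap -/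

/-- **`Q_π(L; T_j, T_jᶜ) = ov(j,j+1)/(2(K+1))`:** only `(j,x) → (j+1,x)` crosses the cut, with
`π(j,x)L((j,x),(j+1,x)) = min{μ_j(x), μ_{j+1}(x)}/(2(K+1))`. [ours] -/
theorem stFinLevel_edgeMeasure_lowerLadder (hμ : ∀ k x, 0 < μ k x) (j : Fin K) :
    edgeMeasure (stFinLaw μ) (stFinLevel μ) (lowerLadder S j) (lowerLadder S j)ᶜ
      = stFinOverlap μ j.castSucc j.succ / (2 * (K + 1)) := by
  have hval : ((j.succ : Fin (K + 1)) : ℕ) = (j : ℕ) + 1 := Fin.val_succ j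
  have hvalc : ((j.castSucc : Fin (K + 1)) : ℕ) = (j : ℕ) := Fin.val_castSucc j
  have hT : ∀ p ∈ lowerLadder S j, ∑ q ∈ (lowerLadder S j)ᶜ, stFinLaw μ p * stFinLevel μ p q
      = if p.1 = j.castSucc then min (μ j.castSucc p.2) (μ j.succ p.2) / (2 * (K + 1)) else 0 := by
    intro p hp
    rw [mem_lowerLadder] at hp
    split_ifs with hpj
    · have hmem : ((j.succ, p.2) : Fin (K + 1) × S) ∈ (lowerLadder S j)ᶜ := by
        rw [mem_compl_lowerLadder, hval]; omega
      rw [Finset.sum_eq_single_of_mem ((j.succ, p.2) : Fin (K + 1) × S) hmem (fun q hq hne => ?_)]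
      · have hqp : ((j.succ, p.2) : Fin (K + 1) × S) ≠ p := fun e => by
          have h1 := congrArg (fun r : Fin (K + 1) × S => (r.1 : ℕ)) e
          simp only [hpj] at h1; simp at h1
        rw [stFinLaw_mul_stFinLevel hμ hqp, if_pos ⟨rfl, Or.inl (by simp [hpj])⟩, hpj]
      · rw [mem_compl_lowerLadder] at hq
        have hqp : q ≠ p := fun e => by rw [e] at hq; omega
        rw [stFinLaw_mul_stFinLevel hμ hqp, if_neg]
        rintro ⟨h2, h | h⟩
        · exact hne (Prod.ext (Fin.ext (by rw [hval, h, hpj, hvalc])) h2)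
        · rw [hpj, hvalc] at h; omega
    · refine sum_eq_zero fun q hq => ?_
      rw [mem_compl_lowerLadder] at hq
      have hqp : q ≠ p := fun e => by rw [e] at hq; omega
      have hlt : (p.1 : ℕ) < j := lt_of_le_of_ne hp (fun e => hpj (Fin.ext (by rw [hvalc]; exact e)))
      rw [stFinLaw_mul_stFinLevel hμ hqp, if_neg]
      rintro ⟨-, h | h⟩ <;> omega
  have h0 : ∀ p ∈ (univ : Finset (Fin (K + 1) × S)), p ∉ lowerLadder S j →
      (if p.1 = j.castSucc then min (μ j.castSucc p.2) (μ j.succ p.2) / (2 * (K + 1)) else 0) = 0 := by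
    intro p _ hp
    rw [mem_lowerLadder, not_le] at hp
    rw [if_neg (fun e => by rw [e, hvalc] at hp; omega)]
  unfold edgeMeasure
  rw [sum_congr rfl hT, Finset.sum_subset (subset_univ (lowerLadder S j)) h0,
    sum_ite_fst_eq j.castSucc (fun p : Fin (K + 1) × S => min (μ j.castSucc p.2) (μ j.succ p.2) / (2 * (K + 1)))]
  unfold stFinOverlap
  rw [← sum_div]

/-- **`Q_π(P; T_j, T_jᶜ) = t·ov(j,j+1)/(2(K+1))`** for `P = stFinSampler t μ M`. [ours] -/
theorem stFin_edgeMeasure_lowerLadder (hμ : ∀ k x, 0 < μ k x) (t : ℝ) (M : Fin (K + 1) → Matrix S S ℝ) (j : Fin K) :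
    edgeMeasure (stFinLaw μ) (stFinSampler t μ M) (lowerLadder S j) (lowerLadder S j)ᶜ
      = t * stFinOverlap μ j.castSucc j.succ / (2 * (K + 1)) := by
  rw [show stFinSampler t μ M = fun p q => t * stFinLevel μ p q + (1 - t) * stFinWithin M p q from rfl,
    levelScheme_edgeMeasure_lowerLadder, stFinLevel_edgeMeasure_lowerLadder hμ, mul_div_assoc]

section Sampler

variable (hμ : ∀ k x, 0 < μ k x) (hμ1 : ∀ k, ∑ x, μ k x = 1) (hM : ∀ k, IsRowStochastic (M k)) (ht0 : 0 ≤ t)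
  (ht1 : t ≤ 1)
include hμ hμ1 hM ht0 ht1

/-- **THE PER-CUT CEILING OF SIMULATED TEMPERING:** `Gap(stFinSampler t μ M) ≤ t(K+1)·ov(j,j+1)/(2(j+1)(K−j))` for every
cut, whatever the (`μ_k`-reversible) within-level updates. [ours] -/
theorem stFinCut_spectralGap_le (hMrev : ∀ k, DetailedBalance (μ k) (M k)) (j : Fin K) :
    spectralGap (stFinLaw μ) (stFinSampler t μ M)
      ≤ t * (K + 1) * stFinOverlap μ j.castSucc j.succ / (2 * ((((j : ℕ) : ℝ) + 1) * ((K : ℝ) - j))) := by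
  have h := levelSchemeCut_spectralGap_le hμ hμ1 hM ht0 ht1 (stFinLevel_isRowStochastic hμ) hMrev
    (stFinLevel_detailedBalance hμ) j
  rw [stFinLevel_edgeMeasure_lowerLadder hμ] at h
  have hK : (0 : ℝ) < K + 1 := by positivity
  calc spectralGap (stFinLaw μ) (stFinSampler t μ M)
      = spectralGap (stFinLaw μ) (fun p q => t * stFinLevel μ p q + (1 - t) * stFinWithin M p q) := rfl
    _ ≤ _ := h
    _ = _ := by field_simp

/-- **THE GAP NEVER EXCEEDS `t` TIMES ANY ADJACENT OVERLAP:** `Gap(stFinSampler t μ M) ≤ t·ov(j,j+1)`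
(`2(j+1)(K−j) ≥ 2K ≥ K+1`). [ours] -/
theorem stFinCut_spectralGap_le_overlap (hMrev : ∀ k, DetailedBalance (μ k) (M k)) (j : Fin K) :
    spectralGap (stFinLaw μ) (stFinSampler t μ M) ≤ t * stFinOverlap μ j.castSucc j.succ := by
  refine (stFinCut_spectralGap_le hμ hμ1 hM ht0 ht1 hMrev j).trans ?_
  have hjK' : ((j : ℕ) : ℝ) + 1 ≤ K := by exact_mod_cast (j.isLt : (j : ℕ) + 1 ≤ K)
  have hj0 : (0 : ℝ) ≤ (j : ℕ) := Nat.cast_nonneg _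
  have hov : 0 ≤ t * stFinOverlap μ j.castSucc j.succ :=
    mul_nonneg ht0 (sum_nonneg fun x _ => le_min (hμ _ _).le (hμ _ _).le)
  have hden : (K : ℝ) + 1 ≤ 2 * ((((j : ℕ) : ℝ) + 1) * ((K : ℝ) - j)) := by nlinarith
  rw [div_le_iff₀ (by nlinarith), mul_assoc t, mul_comm ((K : ℝ) + 1), ← mul_assoc]
  exact mul_le_mul_of_nonneg_left hden hov

/-- **THE PER-CUT MIXING FLOOR OF SIMULATED TEMPERING, NO REVERSIBILITY WITHIN LEVELS:** `μ_k` stationary for `M_k`,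
`d(n) ≤ ¼` ⇒ `min{j+1, K−j} ≤ 2n·t·ov(j,j+1)` for every cut — `t_mix ≥ min{j+1, K−j}/(2t·ov(j,j+1))`. [ours] -/
theorem stFinCut_mixing_floor (hMst : ∀ k, IsStationary (μ k) (M k)) (j : Fin K) {n : ℕ}
    (hn : worstTvDist (stFinSampler t μ M) (stFinLaw μ) n ≤ 1 / 4) :
    min ((((j : ℕ) : ℝ) + 1)) ((K : ℝ) - j) ≤ 2 * n * t * stFinOverlap μ j.castSucc j.succ := by
  have hQ := stFinLevel_isRowStochastic hμ
  have hQst : IsStationary (stFinLaw μ) (stFinLevel μ) := (stFinLevel_detailedBalance hμ).isStationary hQ.2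
  have hK : (0 : ℝ) < K + 1 := by positivity
  have hflow : 4 * (n : ℝ) * (t * (K + 1) * edgeMeasure (stFinLaw μ) (stFinLevel μ) (lowerLadder S j) (lowerLadder S j)ᶜ)
      = 2 * n * t * stFinOverlap μ j.castSucc j.succ := by
    rw [stFinLevel_edgeMeasure_lowerLadder hμ]; field_simp; ring
  rw [show stFinSampler t μ M = fun p q => t * stFinLevel μ p q + (1 - t) * stFinWithin M p q from rfl] at hn
  by_cases hj : 2 * ((j : ℕ) + 1) ≤ K + 1
  · have h := levelSchemeCut_mixing_floor_lower hμ hμ1 hM ht0 ht1 hQ hMst hQst j hj hn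
    exact (min_le_left _ _).trans (by rwa [hflow] at h)
  · have := j.isLt
    have h := levelSchemeCut_mixing_floor_upper hμ hμ1 hM ht0 ht1 hQ hMst hQst j (by omega) hn
    exact (min_le_right _ _).trans (by rwa [hflow] at h)

/-- **THE LOWER-LADDER INDICATOR STAYS CORRELATED:** `0 < t < 1`, irreducible `μ_k`-reversible `M_k` ⇒
`τ_int(f_{T_j}) = asympVar/(2Var) ≥ 2(j+1)(K−j)/(t(K+1)·ov(j,j+1)) − ½` for every cut. [ours] -/
theorem stFinCut_tauInt_ge (hMrev : ∀ k, DetailedBalance (μ k) (M k)) (hMirr : ∀ k, IsIrreducible (M k))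
    (ht0' : 0 < t) (ht1' : t < 1) (j : Fin K) :
    2 * ((((j : ℕ) : ℝ) + 1) * ((K : ℝ) - j)) / (t * (K + 1) * stFinOverlap μ j.castSucc j.succ) - 1 / 2
      ≤ asympVar (bottleneckTestFun (stFinLaw μ) (lowerLadder S j)) (stFinLaw μ) (stFinSampler t μ M)
          / (2 * lawVariance (stFinLaw μ) (bottleneckTestFun (stFinLaw μ) (lowerLadder S j))) := by
  haveI := nontrivial_of_cut (μ := μ) hμ1 j
  have hP := stFinSampler_isRowStochastic (M := M) hμ hM ht0 ht1
  have hDB := stFinSampler_detailedBalance (t := t) (M := M) hμ hMrev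
  have hirr := stFinSampler_isIrreducible hμ hM hMirr ht0' ht1'
  have hπ1 := sum_stFinLaw (K := K) hμ1
  have hK : (0 : ℝ) < K + 1 := by positivity
  have hjK : ((j : ℕ) : ℝ) < K := by exact_mod_cast j.isLt
  have hVar := stFin_lawVariance_cutTestFun (μ := μ) hμ1 j
  have hVpos : 0 < lawVariance (stFinLaw μ) (bottleneckTestFun (stFinLaw μ) (lowerLadder S j)) := by
    rw [hVar]; exact mul_pos (div_pos (by positivity) hK) (div_pos (by linarith) hK)
  have hE : dirichletForm (stFinLaw μ) (stFinSampler t μ M) (bottleneckTestFun (stFinLaw μ) (lowerLadder S j))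
      = t * stFinOverlap μ j.castSucc j.succ / (2 * (K + 1)) := by
    rw [dirichletForm_bottleneckTestFun hP (hDB.isStationary hP.2) hπ1, stFin_edgeMeasure_lowerLadder hμ]
  haveI : Nonempty S := ⟨(Classical.arbitrary (Fin (K + 1) × S)).2⟩
  have hov : 0 < stFinOverlap μ j.castSucc j.succ := sum_pos (fun x _ => lt_min (hμ _ _) (hμ _ _)) univ_nonempty
  have key := tauInt_ge_var_div_dirichletForm (stFinLaw_pos hμ) hπ1 hP hDB hirr hVpos
  rw [hE] at key
  rw [hVar] at key ⊢
  rwa [show 2 * ((((j : ℕ) : ℝ) + 1) * ((K : ℝ) - j)) / (t * (K + 1) * stFinOverlap μ j.castSucc j.succ)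
      = (((j : ℕ) : ℝ) + 1) / (K + 1) * (((K : ℝ) - j) / (K + 1)) / (t * stFinOverlap μ j.castSucc j.succ / (2 * (K + 1)))
      by field_simp]

end Sampler

end Summit.Ventures.LatticeQCDFlow.Scaling

end
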